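import Literature.Analysis.FluidPDE.TorusLinearisedNSGevreyLattice
import HarnessLib

/-!
# The Gevrey balance of the two-background linearised Navier–Stokes equation on `T^d`

Analysis/FluidPDE support file (theorems only; no definitions, no named facts), the TWO-BACKGROUND
twin of `TorusLinearisedNSGevreyBalance`: the Gevrey balance (Foias–Temam, J. Funct. Anal. 87
(1989), Lemma 2.1) of a jointly smooth solution `(w, q)` of

`∂ₜw + (u₁·∇)w + (w·∇)u₂ = νΔw − ∇q`, `div w = 0`, `∫ w = 0`,

along TWO jointly smooth backgrounds on `[t₀, t₁] × T^d` — the advecting background `u₁` and the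
stretched background `u₂` may differ (the equation of the difference of two linearised solutions
along two Gevrey trajectories, and of second variations). Clauses as separate hypotheses, no
predicate. With truncated weights `e_k(t) = exp((t − t₀) min(|k|, N))`, `a_k = ‖ŵ(t,k)‖`, partial
Gevrey sums `Y_R = ∑_{ball R} e² |k|² a²`, `Z_R = ∑_{ball R} e² |k|⁴ a²` and full sum `Y`:

* `NSGevrey.twoBackground_re_inner_mFourierCoeff_timeDerivWithin` — the modewise energy identity
  `Re ⟪𝓕(∂ₜw)(k), ŵ(k)⟫ = −4π²ν|k|² ‖ŵ(k)‖² − Re ⟪𝓕((u₁·∇)w + (w·∇)u₂)(k), ŵ(k)⟫`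
  (the pressure is invisible since `ŵ(k) ⊥ k`; verbatim the one-background proof);
* `Torus.twoBackground_gevreyBalance_le` — the differential inequality: if BOTH backgrounds obey
  the weighted `ℓ¹` Gevrey bound `∑ₘ e^{σ|m|} (1 + |m|) ‖ûⱼ(t, m)‖ ≤ A` on the window and
  `t₁ − t₀ ≤ σ`, then the time derivative of `Y_R(t)` is at most
  `−(5/4)κ Z_R(t) + (2 + 16 C² (2A)²)/κ · Y(t)`, `κ = 4π²ν`, `C = 2π (card d)²` — the pure lattice
  inequality `NSGevrey.linearisedLatticeBalance_le` run with the COMBINED background family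
  `gₘ = ‖û₁(m)‖ + ‖û₂(m)‖` (level `2A`), which dominates both bilinear convolution bounds
  `‖𝓕((u₁·∇)w)(k)‖ ≤ C ∑ₘ ‖û₁(m)‖ |k−m| a_{k−m}`, `‖𝓕((w·∇)u₂)(k)‖ ≤ C ∑ₘ aₘ |k−m| ‖û₂(k−m)‖`
  (`NSGevrey.norm_mFourierCoeff_convect_le`, `NSGevrey.summable_convectMajorant`).

Integration in time and the smoothing theorem are in `TorusTwoBackgroundGevreySmoothing`.
Tree search (`lean search 'twoBackground|gevreyBalance'`): only the one-background balance
`Torus.linearisedNS_gevreyBalance_le`, hard-wired to `u₁ = u₂`.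

Reference: C. Foias, R. Temam, *Gevrey class regularity for the solutions of the Navier–Stokes
equations*, J. Funct. Anal. 87 (1989) 359–369, §2, (2.4)–(2.15). [FoiasTemam1989]
-/

noncomputable section

open MeasureTheory Set Filter UnitAddTorus Function Finset
open scoped Topology BigOperators InnerProductSpace

namespace Literature.Analysis.FluidPDE

namespace NSGevrey

open Literature.Analysis.FunctionSpaces Literature.Analysis.FunctionSpaces.Torus

variable {d : Type*} [Fintype d] [DecidableEq d]

/-! ### The modewise energy identity of the two-background equation -/

section Energy

variable {S : Set ℝ} {ν : ℝ} {u₁ u₂ w : ℝ → UnitAddTorus d → EuclideanSpace ℝ d}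
  {q : ℝ → UnitAddTorus d → ℝ}

/-- **The two-background linearised momentum equation in Fourier variables, paired with the
mode**: for a jointly smooth solution `(w, q)` of `∂ₜw + (u₁·∇)w + (w·∇)u₂ = νΔw − ∇q` with
`div w(t) = 0` along jointly smooth `u₁, u₂` on `S × T^d` and `t ∈ S` (time derivative within `S`),
`Re ⟪𝓕(∂ₜw)(k), ŵ(k)⟫ = −4π²ν|k|² ‖ŵ(k)‖² − (Re ⟪𝓕((u₁·∇)w)(k), ŵ(k)⟫ + Re ⟪𝓕((w·∇)u₂)(k), ŵ(k)⟫)`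
(`𝓕(Δw)(k) = −4π²|k|² ŵ(k)`; the pressure term vanishes since `ŵ(k) ⊥ k`,
`NSGevrey.inner_mFourierCoeff_gradient_eq_zero`) — the proof of
`NSGevrey.linearisedNS_re_inner_mFourierCoeff_timeDerivWithin` verbatim. [cite: FoiasTemam1989, §2 (2.4)–(2.6)] -/
theorem twoBackground_re_inner_mFourierCoeff_timeDerivWithin (hu₁ : IsSmoothSpaceTimeOn S u₁)
    (hu₂ : IsSmoothSpaceTimeOn S u₂) (hw : IsSmoothSpaceTimeOn S w) (hq : IsSmoothSpaceTimeOn S q)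
    (hwdiv : ∀ t ∈ S, IsDivFree (w t))
    (hlin : ∀ t ∈ S, ∀ x, timeDerivWithin S w t x + Torus.convect (u₁ t) (w t) x +
      Torus.convect (w t) (u₂ t) x = ν • Torus.laplacian (w t) x - Torus.gradient (q t) x)
    {t : ℝ} (ht : t ∈ S) (k : d → ℤ) :
    (inner ℂ (mFourierCoeff (EuclideanSpace.complexify ∘ timeDerivWithin S w t) k)
        (mFourierCoeff (EuclideanSpace.complexify ∘ w t) k)).re =
      -(ν * (4 * Real.pi ^ 2 * freqNormSq k)) * ‖mFourierCoeff (EuclideanSpace.complexify ∘ w t) k‖ ^ 2 -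
        ((inner ℂ (mFourierCoeff (EuclideanSpace.complexify ∘ Torus.convect (u₁ t) (w t)) k)
            (mFourierCoeff (EuclideanSpace.complexify ∘ w t) k)).re +
          (inner ℂ (mFourierCoeff (EuclideanSpace.complexify ∘ Torus.convect (w t) (u₂ t)) k)
            (mFourierCoeff (EuclideanSpace.complexify ∘ w t) k)).re) := by
  -- adapted from `NSGevrey.linearisedNS_re_inner_mFourierCoeff_timeDerivWithin` (`TorusLinearisedNSGevreyBalance`)
  have hu₁t : IsSmooth (u₁ t) := hu₁.isSmooth_slice ht
  have hu₂t : IsSmooth (u₂ t) := hu₂.isSmooth_slice ht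
  have hwt : IsSmooth (w t) := hw.isSmooth_slice ht
  have hqt : IsSmooth (q t) := hq.isSmooth_slice ht
  have hc1 : IsSmooth (Torus.convect (u₁ t) (w t)) := hu₁t.convect hwt
  have hc2 : IsSmooth (Torus.convect (w t) (u₂ t)) := hwt.convect hu₂t
  have hpoint : ∀ x, timeDerivWithin S w t x = ν • Torus.laplacian (w t) x -
      Torus.convect (u₁ t) (w t) x - Torus.convect (w t) (u₂ t) x - Torus.gradient (q t) x := by
    intro x
    rw [eq_sub_of_add_eq (eq_sub_of_add_eq (hlin t ht x))]
    abel
  have heq : (EuclideanSpace.complexify ∘ timeDerivWithin S w t) =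
      (ν : ℂ) • (EuclideanSpace.complexify ∘ Torus.laplacian (w t)) -
        EuclideanSpace.complexify ∘ Torus.convect (u₁ t) (w t) -
        EuclideanSpace.complexify ∘ Torus.convect (w t) (u₂ t) -
        EuclideanSpace.complexify ∘ Torus.gradient (q t) := by
    funext x
    simp only [Pi.sub_apply, Pi.smul_apply, Function.comp_apply, hpoint x, map_sub,
      LinearIsometry.map_smul, Complex.coe_smul]
  have hi1 : Integrable (EuclideanSpace.complexify ∘ Torus.laplacian (w t)) volume :=
    integrable_complexify_comp hwt.laplacian.integrable
  have hi2 : Integrable (EuclideanSpace.complexify ∘ Torus.convect (u₁ t) (w t)) volume :=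
    integrable_complexify_comp hc1.integrable
  have hi3 : Integrable (EuclideanSpace.complexify ∘ Torus.convect (w t) (u₂ t)) volume :=
    integrable_complexify_comp hc2.integrable
  have hi4 : Integrable (EuclideanSpace.complexify ∘ Torus.gradient (q t)) volume :=
    integrable_complexify_comp hqt.gradient.integrable
  rw [heq, mFourierCoeff_sub (((hi1.smul (ν : ℂ)).sub hi2).sub hi3) hi4,
    mFourierCoeff_sub ((hi1.smul (ν : ℂ)).sub hi2) hi3, mFourierCoeff_sub (hi1.smul (ν : ℂ)) hi2,
    mFourierCoeff_const_smul, mFourierCoeff_complexify_laplacian hwt]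
  simp only [inner_sub_left, inner_smul_left, inner_neg_left, Complex.conj_ofReal,
    inner_mFourierCoeff_gradient_eq_zero hqt hwt (hwdiv t ht), sub_zero, Complex.sub_re]
  set v : EuclideanSpace ℂ d := mFourierCoeff (EuclideanSpace.complexify ∘ w t) k with hv
  have hself : (inner ℂ v v).re = ‖v‖ ^ 2 := by
    have := inner_self_eq_norm_sq (𝕜 := ℂ) v
    rwa [RCLike.re_to_complex] at this
  have hre : ((ν : ℂ) * -(((4 * Real.pi ^ 2 * freqNormSq k : ℝ) : ℂ) * inner ℂ v v)).re =
      -(ν * (4 * Real.pi ^ 2 * freqNormSq k)) * ‖v‖ ^ 2 := by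
    rw [← hself, show (ν : ℂ) * -(((4 * Real.pi ^ 2 * freqNormSq k : ℝ) : ℂ) * inner ℂ v v) =
      ((-(ν * (4 * Real.pi ^ 2 * freqNormSq k)) : ℝ) : ℂ) * inner ℂ v v by push_cast; ring,
      Complex.re_ofReal_mul]
  rw [hre]
  ring

end Energy

/-! ### The balance along a two-background linearised solution -/

section Solution

variable {ν : ℝ} {t₀ t₁ σ A : ℝ} {u₁ u₂ w : ℝ → UnitAddTorus d → EuclideanSpace ℝ d}
  {q : ℝ → UnitAddTorus d → ℝ}

/-- **The Gevrey balance along a solution of the two-background linearised Navier–Stokes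
equation** (the differential inequality, truncated weights `e_k(t) = exp((t − t₀) min(|k|, N))`,
`κ = 4π²ν`, `C = 2π (card d)²`). Let `(w, q)` solve `∂ₜw + (u₁·∇)w + (w·∇)u₂ = νΔw − ∇q` along
jointly smooth `u₁, u₂` on `[t₀, t₁] × T^d` with divergence-free mean-zero slices `w(t)`, and let
both backgrounds obey the weighted `ℓ¹` Gevrey bound `∑ₘ e^{σ|m|}(1 + |m|) ‖ûⱼ(t, m)‖ ≤ A` on the
window, `t₁ − t₀ ≤ σ`. Then for all `N ≥ 0`, `R`, `t ∈ [t₀, t₁]` the time derivative of the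
partial truncated Gevrey enstrophy `Y_R(t)` of `w`
(`NSGevrey.hasDerivWithinAt_sum_exp_sq_mul_freqNormSq_mul`) is at most
`−(5/4)κ Z_R(t) + (2 + 16 C² (2A)²)/κ · Y(t)` — the lattice theorem
`NSGevrey.linearisedLatticeBalance_le` with the combined background family
`gₘ = ‖û₁(t, m)‖ + ‖û₂(t, m)‖` of level `2A`, which dominates the convolution bounds of both
`(u₁·∇)w` and `(w·∇)u₂`. [cite: FoiasTemam1989, Lemma 2.1 and (2.7)–(2.15)] -/
theorem _root_.Literature.Analysis.FluidPDE.Torus.twoBackground_gevreyBalance_le (hν : 0 < ν)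
    (hu₁ : IsSmoothSpaceTimeOn (Icc t₀ t₁) u₁) (hu₂ : IsSmoothSpaceTimeOn (Icc t₀ t₁) u₂)
    (hw : IsSmoothSpaceTimeOn (Icc t₀ t₁) w) (hq : IsSmoothSpaceTimeOn (Icc t₀ t₁) q)
    (hwdiv : ∀ t ∈ Icc t₀ t₁, IsDivFree (w t)) (hzm : ∀ t ∈ Icc t₀ t₁, HasZeroMean (w t))
    (hlin : ∀ t ∈ Icc t₀ t₁, ∀ x, timeDerivWithin (Icc t₀ t₁) w t x + Torus.convect (u₁ t) (w t) x +
      Torus.convect (w t) (u₂ t) x = ν • Torus.laplacian (w t) x - Torus.gradient (q t) x)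
    (hσ : t₁ - t₀ ≤ σ)
    (hgev₁ : ∀ t ∈ Icc t₀ t₁, (Summable fun m : d → ℤ => Real.exp (σ * Real.sqrt (freqNormSq m)) *
        ((1 + Real.sqrt (freqNormSq m)) * ‖mFourierCoeff (EuclideanSpace.complexify ∘ u₁ t) m‖)) ∧
      ∑' m : d → ℤ, Real.exp (σ * Real.sqrt (freqNormSq m)) *
        ((1 + Real.sqrt (freqNormSq m)) * ‖mFourierCoeff (EuclideanSpace.complexify ∘ u₁ t) m‖) ≤ A)
    (hgev₂ : ∀ t ∈ Icc t₀ t₁, (Summable fun m : d → ℤ => Real.exp (σ * Real.sqrt (freqNormSq m)) *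
        ((1 + Real.sqrt (freqNormSq m)) * ‖mFourierCoeff (EuclideanSpace.complexify ∘ u₂ t) m‖)) ∧
      ∑' m : d → ℤ, Real.exp (σ * Real.sqrt (freqNormSq m)) *
        ((1 + Real.sqrt (freqNormSq m)) * ‖mFourierCoeff (EuclideanSpace.complexify ∘ u₂ t) m‖) ≤ A)
    {N : ℝ} (R : ℕ) {t : ℝ} (hN : 0 ≤ N) (ht : t ∈ Icc t₀ t₁) :
    ∑ k ∈ freqBall R, (2 * min (Real.sqrt (freqNormSq k)) N *
          Real.exp ((t - t₀) * min (Real.sqrt (freqNormSq k)) N) ^ 2 *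
            (freqNormSq k * ‖mFourierCoeff (EuclideanSpace.complexify ∘ w t) k‖ ^ 2) +
        Real.exp ((t - t₀) * min (Real.sqrt (freqNormSq k)) N) ^ 2 * (freqNormSq k *
          (2 * (inner ℂ (mFourierCoeff (EuclideanSpace.complexify ∘ timeDerivWithin (Icc t₀ t₁) w t) k)
            (mFourierCoeff (EuclideanSpace.complexify ∘ w t) k)).re))) ≤
      -(5 / 4 * (4 * Real.pi ^ 2 * ν)) * ∑ k ∈ freqBall R,
          Real.exp ((t - t₀) * min (Real.sqrt (freqNormSq k)) N) ^ 2 *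
            (freqNormSq k ^ 2 * ‖mFourierCoeff (EuclideanSpace.complexify ∘ w t) k‖ ^ 2) +
        (2 + 16 * (2 * Real.pi * (Fintype.card d : ℝ) ^ 2) ^ 2 * (2 * A) ^ 2) / (4 * Real.pi ^ 2 * ν) *
          ∑' k, Real.exp ((t - t₀) * min (Real.sqrt (freqNormSq k)) N) ^ 2 *
            (freqNormSq k * ‖mFourierCoeff (EuclideanSpace.complexify ∘ w t) k‖ ^ 2) := by
  -- adapted from `Torus.linearisedNS_gevreyBalance_le` (`TorusLinearisedNSGevreyBalance`)
  have hκ : 0 < 4 * Real.pi ^ 2 * ν := by positivity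
  have hC : (0 : ℝ) ≤ 2 * Real.pi * (Fintype.card d : ℝ) ^ 2 := by positivity
  have hu₁t : IsSmooth (u₁ t) := hu₁.isSmooth_slice ht
  have hu₂t : IsSmooth (u₂ t) := hu₂.isSmooth_slice ht
  have hwt : IsSmooth (w t) := hw.isSmooth_slice ht
  -- the modewise identity, in the lattice form `-(κ x) a² - r`
  have hmode : ∀ k : d → ℤ,
      (inner ℂ (mFourierCoeff (EuclideanSpace.complexify ∘ timeDerivWithin (Icc t₀ t₁) w t) k)
        (mFourierCoeff (EuclideanSpace.complexify ∘ w t) k)).re =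
      -((4 * Real.pi ^ 2 * ν) * freqNormSq k) * ‖mFourierCoeff (EuclideanSpace.complexify ∘ w t) k‖ ^ 2 -
        ((inner ℂ (mFourierCoeff (EuclideanSpace.complexify ∘ Torus.convect (u₁ t) (w t)) k)
            (mFourierCoeff (EuclideanSpace.complexify ∘ w t) k)).re +
          (inner ℂ (mFourierCoeff (EuclideanSpace.complexify ∘ Torus.convect (w t) (u₂ t)) k)
            (mFourierCoeff (EuclideanSpace.complexify ∘ w t) k)).re) := fun k => by
    rw [twoBackground_re_inner_mFourierCoeff_timeDerivWithin hu₁ hu₂ hw hq hwdiv hlin ht k]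
    ring
  simp only [hmode]
  -- the combined background family `g = ‖û₁‖ + ‖û₂‖`, of level `2A`
  set g : (d → ℤ) → ℝ := fun m => ‖mFourierCoeff (EuclideanSpace.complexify ∘ u₁ t) m‖ +
    ‖mFourierCoeff (EuclideanSpace.complexify ∘ u₂ t) m‖ with hg
  have hg0 : ∀ m, 0 ≤ g m := fun m => add_nonneg (norm_nonneg _) (norm_nonneg _)
  have hgsplit : ∀ m : d → ℤ, Real.exp (σ * Real.sqrt (freqNormSq m)) *
      ((1 + Real.sqrt (freqNormSq m)) * g m) =
      Real.exp (σ * Real.sqrt (freqNormSq m)) * ((1 + Real.sqrt (freqNormSq m)) *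
        ‖mFourierCoeff (EuclideanSpace.complexify ∘ u₁ t) m‖) +
      Real.exp (σ * Real.sqrt (freqNormSq m)) * ((1 + Real.sqrt (freqNormSq m)) *
        ‖mFourierCoeff (EuclideanSpace.complexify ∘ u₂ t) m‖) := fun m => by
    simp only [hg]
    ring
  have hgs : Summable fun m : d → ℤ => Real.exp (σ * Real.sqrt (freqNormSq m)) *
      ((1 + Real.sqrt (freqNormSq m)) * g m) :=
    ((hgev₁ t ht).1.add (hgev₂ t ht).1).congr fun m => (hgsplit m).symm
  have hgA : ∑' m : d → ℤ, Real.exp (σ * Real.sqrt (freqNormSq m)) *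
      ((1 + Real.sqrt (freqNormSq m)) * g m) ≤ 2 * A := by
    rw [tsum_congr hgsplit, ((hgev₁ t ht).1).tsum_add (hgev₂ t ht).1, two_mul]
    exact add_le_add (hgev₁ t ht).2 (hgev₂ t ht).2
  -- the two convolution bounds, dominated by the combined family
  have hconv₁ : ∀ k : d → ℤ, ‖mFourierCoeff (EuclideanSpace.complexify ∘ Torus.convect (u₁ t) (w t)) k‖ ≤
      2 * Real.pi * (Fintype.card d : ℝ) ^ 2 * ∑' m : d → ℤ, g m *
        (Real.sqrt (freqNormSq (k - m)) * ‖mFourierCoeff (EuclideanSpace.complexify ∘ w t) (k - m)‖) := by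
    intro k
    refine (norm_mFourierCoeff_convect_le hu₁t hwt k).trans (mul_le_mul_of_nonneg_left ?_ hC)
    have hs : Summable fun m : d → ℤ => g m * (Real.sqrt (freqNormSq (k - m)) *
        ‖mFourierCoeff (EuclideanSpace.complexify ∘ w t) (k - m)‖) :=
      ((summable_convectMajorant hu₁t hwt k).add (summable_convectMajorant hu₂t hwt k)).congr
        fun m => by simp only [hg]; ring
    exact (summable_convectMajorant hu₁t hwt k).tsum_le_tsum (fun m => mul_le_mul_of_nonneg_right
      (le_add_of_nonneg_right (norm_nonneg _)) (mul_nonneg (Real.sqrt_nonneg _) (norm_nonneg _))) hs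
  have hconv₂ : ∀ k : d → ℤ, ‖mFourierCoeff (EuclideanSpace.complexify ∘ Torus.convect (w t) (u₂ t)) k‖ ≤
      2 * Real.pi * (Fintype.card d : ℝ) ^ 2 * ∑' m : d → ℤ,
        ‖mFourierCoeff (EuclideanSpace.complexify ∘ w t) m‖ * (Real.sqrt (freqNormSq (k - m)) * g (k - m)) := by
    intro k
    refine (norm_mFourierCoeff_convect_le hwt hu₂t k).trans (mul_le_mul_of_nonneg_left ?_ hC)
    have hs : Summable fun m : d → ℤ => ‖mFourierCoeff (EuclideanSpace.complexify ∘ w t) m‖ *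
        (Real.sqrt (freqNormSq (k - m)) * g (k - m)) :=
      ((summable_convectMajorant hwt hu₁t k).add (summable_convectMajorant hwt hu₂t k)).congr
        fun m => by simp only [hg]; ring
    exact (summable_convectMajorant hwt hu₂t k).tsum_le_tsum (fun m => mul_le_mul_of_nonneg_left
      (mul_le_mul_of_nonneg_left (le_add_of_nonneg_left (norm_nonneg _)) (Real.sqrt_nonneg _))
        (norm_nonneg _)) hs
  refine linearisedLatticeBalance_le hκ hC R (fun k => norm_nonneg _) ?_ ?_ hg0 hgs hgA
    (sub_nonneg.2 ht.1) ((sub_le_sub_right ht.2 _).trans hσ) hN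
    (fun k => add_le_add (hconv₁ k) (hconv₂ k)) (fun k => ?_)
  · rw [mFourierCoeff_complexify_zero_of_hasZeroMean hwt.integrable (hzm t ht), norm_zero]
  · have h1 := (summable_weight_mul_freqNormSq_sq_mul hwt (w := fun _ => (1 : ℝ)) (W := 1)
      (fun _ => zero_le_one) (fun _ => le_rfl)).1
    simpa only [one_mul] using h1
  · rw [add_mul]
    exact (abs_add_le _ _).trans (add_le_add ((Complex.abs_re_le_norm _).trans (norm_inner_le_norm _ _))
      ((Complex.abs_re_le_norm _).trans (norm_inner_le_norm _ _)))

end Solution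

end NSGevrey

end Literature.Analysis.FluidPDE
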